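import Summits.Schanuel.Schanuel.Theorems.RootDecomp1KLocalExponent01

/-!
# RootDecomp1KLocalExponent — lens 1, generation 54, NODE 14 «THE LOCAL EXPONENT: the named targets contactC at m₀ = 2 and highContactC at m₀ = 2, 3, 4 decided hypothesis-free» (RULE K-R42 (vii′) named-target clause, K-R44, K-R45) — continuation (RootDecomp1KLocalExponent02): §3 the bounded region near a root, §4 the point (∞,∞) by its Newton slopes

(lens-1 g54 NODE 14 HOME kernel K = HOME/decomp-schanuel-lens-1/g54/LocalExponent.lean 0a24ac98…, 1537 l, 93 thm + 7 def, imports tree …RootDecomp1KHeightMachine05 ONLY (no Literature import); Probe / Ctrl0 / Ctrl + NODE-g54.md + SHA256SUMS; CLAIM L2617, crit EX-ANTE PRICE L2618 (ONE THEOREM ×1 under RULE K-R42 (vii′), NAMED-TARGET clause of L2599, iff CHECKLIST K-g54; RULE K-R45 pre-announced: local toolkit closure + frontier certificate, census instrument LIVENESS-v4), NODE L2621 / REQUEST L2622, census STAGING NOTE 4 L2623, critic VERDICT L2624: CLEARED — THEOREM ×1 under RULE K-R42 (vii′) (named-target clause), CHECKLIST K-g54 met; RULE K-R45 FIXED (local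 suppliers of record; LIVENESS-v4 = frontier certificate; unconditional part DecidedAt ∨ MachineDecidedAt ∨ LocalAt); PORT GO (verbatim; docstrings / the sanctioned privatisation only). Port by census-1 gen 22 as `RootDecomp1KLocalExponent01–06` (`--supports stmt-Schanuel-33364`; no census credit): 01 = §1 helpers + §2 the three local inputs (closed range of ℚ₂ in ℂ₂ `exists_pos_le_norm_ratCast_sub`; the 2-adic LIOUVILLE inequality at a RATIONAL centre `liouville_rat`; the nearest root with its OWN multiplicity); 02 = §3 the bounded region near a root + §4 the point (∞,∞) by its NEWTON SLOPES (`dTop`, `far_slope`, `slope_arith`, `FarClause`, `SlopeCond`, `farClause_of_slopeCond`, `farClause_of_empty`); 03 = §5 THE THEOREM **`thinFibreAt_of_localAt : LocalAt m₀ P → ThinFibreAt m₀ P`** (every m₀; `rootMult`, `RootCond`, `LocalAt`, engine `thinFibreAt_of_rootCond_farClause`, spelled-out `thinFibreAt_local`) + §5b presentation independence `localAt_iff`; 04 = §6 positioning (`localAt_of_thinThreshold_le`, `localAt_of_rootlessTop(_le)`, the tree theorems re-derived) + §7 the top Y⁵ − 1 (`padic_pow_five_eq_one`, `rootCond_two_pow_five_sub_one`)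 + §8 the NAMED TARGETS **`thinFibreAt_contact_two : ThinFibreAt 2 (xPolyP 2 contactC)`**, `thinFibreAt_highContact_three` / `_four` / `_highContact'`; 05 = §9 costume tests of the members + two refused tops; 06 = §10 **`thinFibreAt_highContact_two`** (outside the class: the critical segment v₂(r) = −N!/2 is EMPTY) + §11 bookkeeping ×0 (`LocalOffAt`, residual re-graded). PORT EDITS: the two generic one-liners `norm_natCast_le_one_Cp` / `norm_intCast_le_one_Cp` PRIVATISED (head dry-run dedup.foreign notes vs Summit.ABC… / Summit.BirchSwinnertonDyer… twins; file-local copies re-emitted where used); otherwise none on declarations (K fully documented; no set_option / cite-token); provenance doc blocks + continuation headers = K's own open-lines only; statements and proofs VERBATIM. Rung 0 — nothing here proves Schanuel, 33364, 33363, 31077 or ThinFibre 2; the class `LocalAt` and the named targets are HYPOTHESIS-FREE, §11 is conditional on PadicSubspace / HeightComparison.)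
-/

noncomputable section

namespace Summit.Schanuel.Schanuel.Theorems.RootDecomp1KLocalExponent

open Polynomial LiouvilleNumber
open scoped Nat
open Summit.Schanuel.Schanuel.Theorems.RootDecomp1KTwoBaseCell (psNumer partialSum_eq_psNumer_div coprime_psNumer)
open Summit.Schanuel.Schanuel.Theorems.RootDecomp1KRelLiouvilleCell (partialSum_two_strictMono)
open Summit.Schanuel.Schanuel.Theorems.RootDecomp1KDegreeLadder
open Summit.Schanuel.Schanuel.Theorems.RootDecomp1KXLinearCore
open Summit.Schanuel.Schanuel.Theorems.RootDecomp1KXLinear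
open Summit.Schanuel.Schanuel.Theorems.RootDecomp1KXLinearII
open Summit.Schanuel.Schanuel.Theorems.RootDecomp1KXTop
open Summit.Schanuel.Schanuel.Theorems.RootDecomp1KXAll
open Summit.Schanuel.Schanuel.Theorems.RootDecomp1KLevelFinite
open Summit.Schanuel.Schanuel.Theorems.RootDecomp1KSubspaceBranch
open Summit.Schanuel.Schanuel.Theorems.RootDecomp1KHeightMachine

/-! ## §3  The bounded region: near a root, with THAT root's multiplicity -/

/-- the crude pole datum `D = deg c_k + max_{j<k} deg c_j` (no hypothesis on the degrees). -/
def dTop (k : ℕ) (c : ℕ → ℤ[X]) : ℕ := (c k).natDegree + (Finset.range k).sup fun j => (c j).natDegree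

/-- domination of the top coefficient with the crude datum: `‖c_k(r)‖₂ ≤ 2^{−N!}·max(1,‖r‖₂)^{D}` (tree
`top_coeff_small` with `e := max_{j<k} deg c_j`). -/
theorem top_coeff_small' (k : ℕ) (c : ℕ → ℤ[X]) {N : ℕ} (hN : 3 ≤ N) (r : ℚ)
    (hP : bev (xPolyP k c) (partialSum 2 N) r = 0) :
    ‖aeval (r : PadicAlgCl 2) (c k)‖ ≤ (1 / 2 : ℝ) ^ N ! * max 1 ‖(r : PadicAlgCl 2)‖ ^ dTop k c := by
  have hdeg : ∀ j, j < k → (c j).natDegree ≤ (c k).natDegree + (Finset.range k).sup fun j => (c j).natDegree := by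
    intro j hj
    exact le_add_left (Finset.le_sup (f := fun j => (c j).natDegree) (Finset.mem_range.mpr hj))
  exact top_coeff_small k c _ hdeg hN r hP

/-- **the bounded region**: for `c_k` of degree `≥ 1` and any `2`-adic radius `R`, for `N ≥ N₁(R)` every level point
`r` with `‖r‖₂ ≤ R` has a root `β` of `c_k` with `‖r − β‖₂ < 1` and `‖r − β‖₂^{n β} ≤ cc·2^{−N!}`, `n β` THE
multiplicity of `β` (not the maximal one). -/
theorem near_root_own_mult (k : ℕ) (c : ℕ → ℤ[X]) (hd : 1 ≤ (c k).natDegree) (R : ℝ) :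
    ∃ (T : Finset (PadicAlgCl 2)) (n : PadicAlgCl 2 → ℕ) (cc : ℝ) (N₁ : ℕ), 0 < cc ∧
      (∀ β ∈ T, aeval β (c k) = 0) ∧ (∀ β ∈ T, 1 ≤ n β) ∧
      (∀ β, n β = rootMultiplicity β ((c k).map (algebraMap ℤ (PadicAlgCl 2)))) ∧
      ∀ N, N₁ ≤ N → ∀ r : ℚ, bev (xPolyP k c) (partialSum 2 N) r = 0 → ‖(r : PadicAlgCl 2)‖ ≤ R →
        ∃ β ∈ T, ‖(r : PadicAlgCl 2) - β‖ < 1 ∧ ‖(r : PadicAlgCl 2) - β‖ ^ n β ≤ cc * (1 / 2 : ℝ) ^ N ! := by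
  classical
  obtain ⟨T, n, c₀, hc₀, hroots, hn1, hnmult, -, -, hnear⟩ := nearest_root_sharp (c k) hd
  set M : ℝ := max 1 R with hMdef
  have hM1 : 1 ≤ M := le_max_left _ _
  have hMpos : 0 < M := lt_of_lt_of_le one_pos hM1
  set cc : ℝ := c₀ * M ^ dTop k c with hccdef
  have hccpos : 0 < cc := mul_pos hc₀ (pow_pos hMpos _)
  obtain ⟨N₁', hN₁'⟩ := exists_pow_lt_of_lt_one (one_div_pos.mpr hccpos) (show (1 / 2 : ℝ) < 1 by norm_num)
  refine ⟨T, n, cc, max N₁' 3, hccpos, hroots, hn1, hnmult, fun N hN r hP hrR => ?_⟩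
  have hN3 : 3 ≤ N := le_trans (le_max_right _ _) hN
  have hNN₁' : N₁' ≤ N := le_trans (le_max_left _ _) hN
  have hdom := top_coeff_small' k c hN3 r hP
  have hmax : max 1 ‖(r : PadicAlgCl 2)‖ ≤ M := max_le hM1 (hrR.trans (le_max_right _ _))
  have hBle : ‖aeval (r : PadicAlgCl 2) (c k)‖ ≤ (1 / 2 : ℝ) ^ N ! * M ^ dTop k c :=
    hdom.trans (mul_le_mul_of_nonneg_left
      (pow_le_pow_left₀ (le_trans zero_le_one (le_max_left _ _)) hmax _) (by positivity))
  obtain ⟨β, hβT, hβ⟩ := hnear (r : PadicAlgCl 2)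
  have hsmall : min 1 ‖(r : PadicAlgCl 2) - β‖ ^ n β ≤ cc * (1 / 2 : ℝ) ^ N ! :=
    hβ.trans (by
      calc c₀ * ‖aeval (r : PadicAlgCl 2) (c k)‖ ≤ c₀ * ((1 / 2 : ℝ) ^ N ! * M ^ dTop k c) := by gcongr
        _ = cc * (1 / 2 : ℝ) ^ N ! := by rw [hccdef]; ring)
  have hlt1 : cc * (1 / 2 : ℝ) ^ N ! < 1 := by
    have h1 : (1 / 2 : ℝ) ^ N ! ≤ (1 / 2 : ℝ) ^ N₁' :=
      pow_le_pow_of_le_one (by norm_num) (by norm_num) (hNN₁'.trans (Nat.self_le_factorial N))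
    have h2 : cc * (1 / 2 : ℝ) ^ N ! < cc * (1 / cc) := mul_lt_mul_of_pos_left (lt_of_le_of_lt h1 hN₁') hccpos
    rwa [mul_one_div_cancel hccpos.ne'] at h2
  have hrβ : ‖(r : PadicAlgCl 2) - β‖ < 1 := by
    by_contra hge
    push Not at hge
    rw [min_eq_left hge, one_pow] at hsmall
    linarith
  rw [min_eq_right hrβ.le] at hsmall
  exact ⟨β, hβT, hrβ, hsmall⟩

/-! ## §4  The point `(∞, ∞)` by its NEWTON SLOPES -/

/-- **the slope datum at `(∞,∞)`** (ultrametric Newton polygon of the level identity): for `N ≥ N₁` every level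
point `r` with `‖r‖₂ > R₀` (beyond all roots of `c_k`) has an index `j < k` with `deg c_j > deg c_k` and
`‖lc‖₂·2^{(k−j)N!} ≤ ‖r‖₂^{deg c_j − deg c_k}` (a dominant `j` with `deg c_j ≤ deg c_k` is impossible). -/
theorem far_slope (k : ℕ) (c : ℕ → ℤ[X]) (hB : c k ≠ 0) :
    ∃ (R₀ : ℝ) (N₁ : ℕ), 1 ≤ R₀ ∧ ∀ N, N₁ ≤ N → ∀ r : ℚ, bev (xPolyP k c) (partialSum 2 N) r = 0 →
      R₀ < ‖(r : PadicAlgCl 2)‖ →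
      ∃ j, j < k ∧ (c k).natDegree < (c j).natDegree ∧
        ‖((c k).leadingCoeff : PadicAlgCl 2)‖ * 2 ^ ((k - j) * N !) ≤
          ‖(r : PadicAlgCl 2)‖ ^ ((c j).natDegree - (c k).natDegree) := by
  classical
  obtain ⟨T, n, -, -, -, hsum, hprod⟩ := roots_data_mult (c k) hB
  set ℓ : PadicAlgCl 2 := ((c k).leadingCoeff : PadicAlgCl 2) with hℓdef
  have hℓpos : 0 < ‖ℓ‖ := by rw [norm_pos_iff, hℓdef]; exact_mod_cast leadingCoeff_ne_zero.mpr hB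
  set R₀ : ℝ := 1 + ∑ β ∈ T, ‖β‖ with hR₀
  have hR₀1 : 1 ≤ R₀ := by
    have : 0 ≤ ∑ β ∈ T, ‖β‖ := Finset.sum_nonneg fun β _ => norm_nonneg β
    linarith
  have hR₀β : ∀ β ∈ T, ‖β‖ < R₀ := by
    intro β hβ
    have := Finset.single_le_sum (f := fun β => ‖β‖) (fun β _ => norm_nonneg β) hβ
    linarith
  obtain ⟨N₁, hN₁⟩ := exists_pow_lt_of_lt_one hℓpos (show (1 / 2 : ℝ) < 1 by norm_num)
  refine ⟨R₀, max N₁ 3, hR₀1, fun N hN r hP hrR => ?_⟩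
  have hN3 : 3 ≤ N := le_trans (le_max_right _ _) hN
  have hNN₁ : N₁ ≤ N := le_trans (le_max_left _ _) hN
  have hr1 : 1 ≤ ‖(r : PadicAlgCl 2)‖ := hR₀1.trans hrR.le
  have hrpos : 0 < ‖(r : PadicAlgCl 2)‖ := lt_of_lt_of_le one_pos hr1
  have hp1 : ‖(psNumer 2 N : PadicAlgCl 2)‖ = 1 := norm_psNumer hN3
  have hfac : ∀ β ∈ T, ‖(r : PadicAlgCl 2) - β‖ ^ n β = ‖(r : PadicAlgCl 2)‖ ^ n β := by
    intro β hβ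
    have hne : ‖(r : PadicAlgCl 2)‖ ≠ ‖-β‖ := by
      rw [norm_neg]; exact ne_of_gt ((hR₀β β hβ).trans hrR)
    rw [sub_eq_add_neg, IsUltrametricDist.norm_add_eq_max_of_norm_ne_norm hne, norm_neg,
      max_eq_left ((hR₀β β hβ).trans hrR).le]
  have hBn : ‖aeval (r : PadicAlgCl 2) (c k)‖ = ‖ℓ‖ * ‖(r : PadicAlgCl 2)‖ ^ (c k).natDegree := by
    rw [hprod, norm_mul, norm_prod]
    simp only [norm_pow]
    rw [Finset.prod_congr rfl hfac, Finset.prod_pow_eq_pow_sum, hsum]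
  have htop := level_identity k c N r hP
  have hlhs : ‖(psNumer 2 N : PadicAlgCl 2) ^ k * aeval (r : PadicAlgCl 2) (c k)‖ =
      ‖ℓ‖ * ‖(r : PadicAlgCl 2)‖ ^ (c k).natDegree := by
    rw [norm_mul, norm_pow, hp1, one_pow, one_mul, hBn]
  have hsmallfalse : ¬ (‖ℓ‖ ≤ (1 / 2 : ℝ) ^ N !) := by
    intro h
    have h4 : (1 / 2 : ℝ) ^ N ! ≤ (1 / 2 : ℝ) ^ N₁ :=
      pow_le_pow_of_le_one (by norm_num) (by norm_num) (hNN₁.trans (Nat.self_le_factorial N))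
    linarith
  rcases Nat.eq_zero_or_pos k with hk0 | hkpos
  · -- `k = 0`: the level identity says `c_0(r) = 0`, but `‖c_0(r)‖ = ‖lc‖‖r‖^d > 0`
    exfalso
    subst hk0
    have h0 : (psNumer 2 N : PadicAlgCl 2) ^ 0 * aeval (r : PadicAlgCl 2) (c 0) = 0 := by
      rw [htop]; simp
    have h0' : ‖ℓ‖ * ‖(r : PadicAlgCl 2)‖ ^ (c 0).natDegree = 0 := by rw [← hlhs, h0, norm_zero]
    have hpos : 0 < ‖ℓ‖ * ‖(r : PadicAlgCl 2)‖ ^ (c 0).natDegree := mul_pos hℓpos (pow_pos hrpos _)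
    linarith
  · have hne : (Finset.range k).Nonempty := Finset.nonempty_range_iff.mpr (by omega)
    obtain ⟨j, hj, hjle⟩ := IsUltrametricDist.exists_norm_finsetSum_le_of_nonempty hne
      (fun j => (psNumer 2 N : PadicAlgCl 2) ^ j * 2 ^ ((k - j) * N !) * aeval (r : PadicAlgCl 2) (c j))
    have hjk : j < k := Finset.mem_range.mp hj
    have hterm : ‖(psNumer 2 N : PadicAlgCl 2) ^ j * 2 ^ ((k - j) * N !) * aeval (r : PadicAlgCl 2) (c j)‖ ≤
        (1 / 2 : ℝ) ^ ((k - j) * N !) * ‖(r : PadicAlgCl 2)‖ ^ (c j).natDegree := by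
      rw [norm_mul, norm_mul, norm_pow, hp1, one_pow, one_mul, norm_two_pow_Cp]
      refine mul_le_mul_of_nonneg_left ?_ (by positivity)
      have := norm_aeval_le (c j) (r : PadicAlgCl 2)
      rwa [max_eq_right hr1] at this
    have hmain : ‖ℓ‖ * ‖(r : PadicAlgCl 2)‖ ^ (c k).natDegree ≤
        (1 / 2 : ℝ) ^ ((k - j) * N !) * ‖(r : PadicAlgCl 2)‖ ^ (c j).natDegree := by
      rw [← hlhs, htop, norm_neg]; exact hjle.trans hterm
    have hhalfle : (1 / 2 : ℝ) ^ ((k - j) * N !) ≤ (1 / 2 : ℝ) ^ N ! :=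
      pow_le_pow_of_le_one (by norm_num) (by norm_num) (Nat.le_mul_of_pos_left _ (by omega))
    by_cases hdj : (c j).natDegree ≤ (c k).natDegree
    · -- impossible: `‖lc‖ ≤ 2^{−(k−j)N!}`
      exfalso
      apply hsmallfalse
      have h1 : ‖ℓ‖ * ‖(r : PadicAlgCl 2)‖ ^ (c k).natDegree ≤
          (1 / 2 : ℝ) ^ ((k - j) * N !) * ‖(r : PadicAlgCl 2)‖ ^ (c k).natDegree :=
        hmain.trans (mul_le_mul_of_nonneg_left (pow_le_pow_right₀ hr1 hdj) (by positivity))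
      exact (le_of_mul_le_mul_right h1 (pow_pos hrpos _)).trans hhalfle
    · push Not at hdj
      refine ⟨j, hjk, hdj, ?_⟩
      have hsplit : ‖(r : PadicAlgCl 2)‖ ^ (c j).natDegree =
          ‖(r : PadicAlgCl 2)‖ ^ ((c j).natDegree - (c k).natDegree) * ‖(r : PadicAlgCl 2)‖ ^ (c k).natDegree := by
        rw [← pow_add, Nat.sub_add_cancel hdj.le]
      rw [hsplit, ← mul_assoc] at hmain
      have h2 : ‖ℓ‖ ≤ (1 / 2 : ℝ) ^ ((k - j) * N !) * ‖(r : PadicAlgCl 2)‖ ^ ((c j).natDegree - (c k).natDegree) :=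
        le_of_mul_le_mul_right hmain (pow_pos hrpos _)
      have h2pos : (0 : ℝ) < 2 ^ ((k - j) * N !) := by positivity
      have hhalf : (1 / 2 : ℝ) ^ ((k - j) * N !) * 2 ^ ((k - j) * N !) = 1 := by
        rw [div_pow, one_pow, div_mul_cancel₀ _ (ne_of_gt h2pos)]
      calc ‖ℓ‖ * 2 ^ ((k - j) * N !)
          ≤ (1 / 2 : ℝ) ^ ((k - j) * N !) * ‖(r : PadicAlgCl 2)‖ ^ ((c j).natDegree - (c k).natDegree) *
              2 ^ ((k - j) * N !) := mul_le_mul_of_nonneg_right h2 h2pos.le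
        _ = ‖(r : PadicAlgCl 2)‖ ^ ((c j).natDegree - (c k).natDegree) := by
            rw [mul_comm, ← mul_assoc, mul_comm (2 ^ ((k - j) * N !) : ℝ), hhalf, one_mul]

/-- **the arithmetic of a slope**: `ℓ·2^{b·N!} ≤ d^a` with `a + 1 ≤ m₀·b` (`ℓ > 0` fixed) forces
`C·2^{(N+1)!} < d^{m₀N}` for `N` large.  (`W = 2^{N!}`; if `d^{m₀N} ≤ C·W^{N+1}` then
`ℓ^{m₀N}·W^{b·m₀·N} ≤ d^{a·m₀·N} ≤ C^a·W^{a(N+1)}`, so `W^{N−a} ≤ ℓ^{−m₀N}·C^a ≤ G^{N+1} ≤ W^{N−a−1}` — absurd;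
`a = e`, `b = 1` is the tree's `infinity_arith`.) -/
theorem slope_arith (ℓ C : ℝ) (hℓ : 0 < ℓ) (a b m₀ : ℕ) (hab : a + 1 ≤ m₀ * b) :
    ∃ N₂ : ℕ, ∀ N, N₂ ≤ N → ∀ d : ℕ, 1 ≤ d → ℓ * 2 ^ (b * N !) ≤ (d : ℝ) ^ a →
      C * 2 ^ (N + 1)! < (d : ℝ) ^ (m₀ * N) := by
  set G : ℝ := max 1 (C ^ a) * max 1 ((1 / ℓ) ^ m₀) with hG
  have hG1 : 1 ≤ max 1 ((1 / ℓ) ^ m₀) := le_max_left _ _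
  have hC1 : 1 ≤ max 1 (C ^ a) := le_max_left _ _
  obtain ⟨N₂, hN₂⟩ := eventually_pow_le' G (a + 1)
  refine ⟨max N₂ (a + 1), fun N hN d hd hx => ?_⟩
  have hNN₂ : N₂ ≤ N := le_trans (le_max_left _ _) hN
  have hNa : a + 1 ≤ N := le_trans (le_max_right _ _) hN
  have hdR : (1 : ℝ) ≤ d := by exact_mod_cast hd
  set W : ℝ := 2 ^ N ! with hW
  have hWpos : 0 < W := by positivity
  have hW1 : 1 < W := by rw [hW]; exact one_lt_pow₀ (by norm_num) (Nat.factorial_pos N).ne'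
  have hfact : (2 : ℝ) ^ (N + 1)! = W ^ (N + 1) := by
    rw [hW, ← pow_mul]; congr 1; rw [Nat.factorial_succ, mul_comm]
  have hxW : ℓ * W ^ b ≤ (d : ℝ) ^ a := by rw [hW, ← pow_mul, mul_comm (N !) b]; exact hx
  rw [hfact]
  by_contra hle
  push Not at hle
  have h1 : (ℓ * W ^ b) ^ (m₀ * N) ≤ ((d : ℝ) ^ a) ^ (m₀ * N) := pow_le_pow_left₀ (by positivity) hxW _
  have h2 : ((d : ℝ) ^ a) ^ (m₀ * N) ≤ (C * W ^ (N + 1)) ^ a := by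
    rw [← pow_mul, mul_comm a, pow_mul]
    exact pow_le_pow_left₀ (by positivity) hle _
  have h12 : ℓ ^ (m₀ * N) * W ^ (b * (m₀ * N)) ≤ C ^ a * W ^ (a * (N + 1)) := by
    have hL : (ℓ * W ^ b) ^ (m₀ * N) = ℓ ^ (m₀ * N) * W ^ (b * (m₀ * N)) := by rw [mul_pow, ← pow_mul]
    have hR : (C * W ^ (N + 1)) ^ a = C ^ a * W ^ (a * (N + 1)) := by rw [mul_pow, ← pow_mul, mul_comm (N + 1) a]
    rw [← hL, ← hR]; exact h1.trans h2
  have hexp : a * (N + 1) + (N - a) ≤ b * (m₀ * N) := by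
    have h0 : (a + 1) * N ≤ m₀ * b * N := Nat.mul_le_mul_right _ hab
    have h' : a * (N + 1) + (N - a) = (a + 1) * N := by
      zify [show a ≤ N by omega]; ring
    rw [h']
    calc (a + 1) * N ≤ m₀ * b * N := h0
      _ = b * (m₀ * N) := by ring
  have h3 : ℓ ^ (m₀ * N) * (W ^ (a * (N + 1)) * W ^ (N - a)) ≤ C ^ a * W ^ (a * (N + 1)) := by
    refine le_trans ?_ h12
    refine mul_le_mul_of_nonneg_left ?_ (by positivity)
    rw [← pow_add]; exact pow_le_pow_right₀ hW1.le hexp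
  have hWa : 0 < W ^ (a * (N + 1)) := by positivity
  have h4 : ℓ ^ (m₀ * N) * W ^ (N - a) ≤ C ^ a := by
    have h' : ℓ ^ (m₀ * N) * W ^ (N - a) * W ^ (a * (N + 1)) ≤ C ^ a * W ^ (a * (N + 1)) := by
      calc ℓ ^ (m₀ * N) * W ^ (N - a) * W ^ (a * (N + 1))
          = ℓ ^ (m₀ * N) * (W ^ (a * (N + 1)) * W ^ (N - a)) := by ring
        _ ≤ C ^ a * W ^ (a * (N + 1)) := h3
    exact le_of_mul_le_mul_right h' hWa
  have hℓpow : 0 < ℓ ^ (m₀ * N) := by positivity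
  have h5 : W ^ (N - a) ≤ C ^ a * (1 / ℓ) ^ (m₀ * N) := by
    rw [one_div, inv_pow, ← div_eq_mul_inv, le_div_iff₀ hℓpow]
    linarith [h4]
  have hBB : (1 / ℓ) ^ (m₀ * N) ≤ (max 1 ((1 / ℓ) ^ m₀)) ^ (N + 1) := by
    rcases le_or_gt (1 / ℓ) 1 with hs | hs
    · exact (pow_le_one₀ (by positivity) hs).trans (one_le_pow₀ hG1)
    · calc (1 / ℓ) ^ (m₀ * N) ≤ (1 / ℓ) ^ (m₀ * (N + 1)) :=
            pow_le_pow_right₀ hs.le (Nat.mul_le_mul_left _ (Nat.le_succ N))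
        _ = ((1 / ℓ) ^ m₀) ^ (N + 1) := by rw [← pow_mul]
        _ ≤ (max 1 ((1 / ℓ) ^ m₀)) ^ (N + 1) := pow_le_pow_left₀ (by positivity) (le_max_right _ _) _
  have h6 : W ^ (N - a) ≤ G ^ (N + 1) := by
    refine h5.trans ?_
    calc C ^ a * (1 / ℓ) ^ (m₀ * N)
        ≤ max 1 (C ^ a) * (max 1 ((1 / ℓ) ^ m₀)) ^ (N + 1) :=
          mul_le_mul (le_max_right _ _) hBB (by positivity) (by positivity)
      _ ≤ (max 1 (C ^ a)) ^ (N + 1) * (max 1 ((1 / ℓ) ^ m₀)) ^ (N + 1) := by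
          refine mul_le_mul_of_nonneg_right (le_self_pow₀ hC1 (by omega)) (by positivity)
      _ = G ^ (N + 1) := by rw [hG, mul_pow]
  have h7 : G ^ (N + 1) ≤ (2 : ℝ) ^ ((N - (a + 1)) * N !) := hN₂ N hNN₂
  have h8 : (2 : ℝ) ^ ((N - (a + 1)) * N !) = W ^ (N - (a + 1)) := by rw [hW, ← pow_mul, mul_comm]
  have h9 : W ^ (N - (a + 1)) < W ^ (N - a) := pow_lt_pow_right₀ hW1 (by omega)
  rw [h8] at h7
  linarith

/-- [datum def, census convention: a typed local condition, NOT a fact] the **FAR CLAUSE** of `P = xPolyP k c` at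
quality `m₀`: beyond SOME `2`-adic radius `R`, the level points satisfy the thin-fibre clause for large `N`
(supplied by the slopes, `farClause_of_slopeCond`, or by emptiness of the far region, `farClause_of_empty`). -/
def FarClause (m₀ k : ℕ) (c : ℕ → ℤ[X]) : Prop :=
  ∃ R : ℝ, ∀ C : ℝ, ∃ N₁ : ℕ, ∀ N, N₁ ≤ N → ∀ r : ℚ, bev (xPolyP k c) (partialSum 2 N) r = 0 →
    R < ‖(r : PadicAlgCl 2)‖ → C * 2 ^ (N + 1)! < (r.den : ℝ) ^ (m₀ * N)

/-- [datum def] the **SLOPE CONDITION** at `(∞,∞)` at quality `m₀`: every Newton slope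
`(k − j)/(deg c_j − deg c_k)` of the level identity exceeds `1/m₀`. -/
def SlopeCond (m₀ k : ℕ) (c : ℕ → ℤ[X]) : Prop :=
  ∀ j, j < k → (c k).natDegree < (c j).natDegree → (c j).natDegree - (c k).natDegree < m₀ * (k - j)

/-- **supplier (S)**: the slope condition gives the far clause (no Diophantine input: `den r ≥ ‖r‖₂`). -/
theorem farClause_of_slopeCond (k : ℕ) (c : ℕ → ℤ[X]) (hB : c k ≠ 0) {m₀ : ℕ} (hS : SlopeCond m₀ k c) :
    FarClause m₀ k c := by
  classical
  obtain ⟨R₀, N₁, -, hfar⟩ := far_slope k c hB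
  have hℓpos : 0 < ‖((c k).leadingCoeff : PadicAlgCl 2)‖ := by
    rw [norm_pos_iff]; exact_mod_cast leadingCoeff_ne_zero.mpr hB
  refine ⟨R₀, fun C => ?_⟩
  have hN₂ : ∀ j, ∃ N₂ : ℕ, j < k → (c k).natDegree < (c j).natDegree → ∀ N, N₂ ≤ N → ∀ d : ℕ, 1 ≤ d →
      ‖((c k).leadingCoeff : PadicAlgCl 2)‖ * 2 ^ ((k - j) * N !) ≤ (d : ℝ) ^ ((c j).natDegree - (c k).natDegree) →
      C * 2 ^ (N + 1)! < (d : ℝ) ^ (m₀ * N) := by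
    intro j
    by_cases hjk : j < k
    · by_cases hdj : (c k).natDegree < (c j).natDegree
      · obtain ⟨N₂, hN₂⟩ := slope_arith ‖((c k).leadingCoeff : PadicAlgCl 2)‖ C hℓpos
          ((c j).natDegree - (c k).natDegree) (k - j) m₀ (Nat.succ_le_of_lt (hS j hjk hdj))
        exact ⟨N₂, fun _ _ => hN₂⟩
      · exact ⟨0, fun _ h => (hdj h).elim⟩
    · exact ⟨0, fun h => (hjk h).elim⟩
  choose N₂ hN₂ using hN₂
  refine ⟨N₁ + (Finset.range k).sup N₂, fun N hN r hP hrR => ?_⟩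
  obtain ⟨j, hjk, hdj, hineq⟩ := hfar N (le_trans (Nat.le_add_right _ _) hN) r hP hrR
  have hjN : N₂ j ≤ N :=
    le_trans (Finset.le_sup (f := N₂) (Finset.mem_range.mpr hjk)) (le_trans (Nat.le_add_left _ _) hN)
  refine hN₂ j hjk hdj N hjN r.den (Nat.succ_le_of_lt r.den_pos) (hineq.trans ?_)
  exact pow_le_pow_left₀ (norm_nonneg _) (norm_ratCast_le_den r) _

/-- **supplier (E)**: an eventually EMPTY far region gives the far clause at every quality. -/
theorem farClause_of_empty {k : ℕ} {c : ℕ → ℤ[X]} (R : ℝ) (N₁ : ℕ)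
    (h : ∀ N, N₁ ≤ N → ∀ r : ℚ, bev (xPolyP k c) (partialSum 2 N) r = 0 → ‖(r : PadicAlgCl 2)‖ ≤ R) (m₀ : ℕ) :
    FarClause m₀ k c :=
  ⟨R, fun _ => ⟨N₁, fun N hN r hP hrR => (lt_irrefl _ (hrR.trans_le (h N hN r hP))).elim⟩⟩

end Summit.Schanuel.Schanuel.Theorems.RootDecomp1KLocalExponent

end
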